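import Mathlib
import Summits.ValiantsHypothesis.ValiantsHypothesis.Theorems.LacunarySymmetroidMatrixDescartesDefiniteMomentsZonesRayleigh

/-!
# `MatrixDescartes` (stmt-ValiantsHypothesis-18050) — the DEFINITE-MOMENTS LAW, budget zones I: Rayleigh families that are
# Descartes-sharp FOR A GIVEN BUDGET (the abstract hypothesis bundle of the lacunary Markus theorem)

HONEST FRAMING.  Cell `pub-symmetroid`, seat `val-sym-mdr-p2` (gen 15); helper file `--supports` the crux
`Theses.LacunarySymmetroid.MatrixDescartes`, NO closure claim.  Bookkeeping that re-runs `…DefiniteMomentsZonesRayleigh` under an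
ABSTRACT BUDGET `B` instead of Descartes' `K − 1`, so that the zone machinery applies to semidefinite SIGN WORDS (budget = number
of sign changes of the word) as well as to Rayleigh-sharp pencils; nothing here bears on the crux in its window, on
`stub_twoSided`, on `DoorA26`/`DoorA34`, registers, or `VP ≠ VNP`.

HYPOTHESIS BUNDLE for `F(x) = ∑ₗ x^{dₗ}Sₗ` (letters indexed by `Fin K`, ANY exponents) with Rayleigh `K`-nomials
`P_u = ∑ₗ (uᵀSₗu)X^{dₗ}` and positive root sets `T_u`:
* BUDGET `hB`: for every `u`, `P_u` has at most `B` positive roots COUNTED WITH MULTIPLICITY;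
* SHARPNESS `hsh`: for every `u ≠ 0`, `#T_u ≥ B`;
* SIGN `hs`: one sign `s` such that every `P_u` (`u ≠ 0`) has the sign `s` on some `(0, δ)`.
Consequences: `budget_ne_zero`, `budget_card_eq` (`#T_u = B`), `budget_multiset`, `budget_enum` (increasing enumeration
`Fin B → ℝ`), `budget_form_le` (the budget in Rayleigh-form currency), and the PARITY LAW `budget_sign_law`
(`0 < s·(−1)^{N(x,u)}·uᵀF(x)u` at positive non-roots). [folklore]; axioms standard; no definitions.
-/

-- layout Summits/ValiantsHypothesis/ValiantsHypothesis forces the duplicated namespace component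
set_option linter.dupNamespace false

namespace Summit.ValiantsHypothesis.ValiantsHypothesis.Theorems.LacunarySymmetroidMatrixDescartes

open Polynomial Matrix Finset
open scoped BigOperators

namespace DefiniteMoments

section Budget

variable {ι : Type} [Fintype ι] {K : ℕ}

/-- Under the sign hypothesis, `P_u ≠ 0` for `u ≠ 0`. [folklore] -/
theorem budget_ne_zero (d : Fin K → ℕ) (S : Fin K → Matrix ι ι ℝ) (s : ℝ)
    (hs : ∀ u : ι → ℝ, u ≠ 0 → ∃ δ : ℝ, 0 < δ ∧ ∀ x : ℝ, 0 < x → x < δ →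
      0 < s * (∑ l, C (u ⬝ᵥ (S l *ᵥ u)) * (X : ℝ[X]) ^ d l).eval x)
    (u : ι → ℝ) (hu : u ≠ 0) : (∑ l, C (u ⬝ᵥ (S l *ᵥ u)) * (X : ℝ[X]) ^ d l) ≠ 0 := by
  intro h0
  obtain ⟨δ, hδ, h⟩ := hs u hu
  have h1 := h (δ / 2) (by linarith) (by linarith)
  rw [h0, Polynomial.eval_zero, mul_zero] at h1
  exact lt_irrefl 0 h1

/-- `#T_u = B` exactly. [folklore] -/
theorem budget_card_eq (d : Fin K → ℕ) (S : Fin K → Matrix ι ι ℝ) (B : ℕ)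
    (hB : ∀ u : ι → ℝ, ((∑ l, C (u ⬝ᵥ (S l *ᵥ u)) * (X : ℝ[X]) ^ d l).roots.filter (fun t => 0 < t)).card ≤ B)
    (hsh : ∀ u : ι → ℝ, u ≠ 0 →
      B ≤ ((∑ l, C (u ⬝ᵥ (S l *ᵥ u)) * (X : ℝ[X]) ^ d l).roots.toFinset.filter (fun t => 0 < t)).card)
    (u : ι → ℝ) (hu : u ≠ 0) :
    ((∑ l, C (u ⬝ᵥ (S l *ᵥ u)) * (X : ℝ[X]) ^ d l).roots.toFinset.filter (fun t => 0 < t)).card = B := by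
  apply le_antisymm _ (hsh u hu)
  refine le_trans ?_ (hB u)
  rw [← Multiset.toFinset_filter]
  exact Multiset.toFinset_card_le _

/-- No repeated positive root (multiset count ≤ distinct count). [folklore] -/
theorem budget_multiset (d : Fin K → ℕ) (S : Fin K → Matrix ι ι ℝ) (B : ℕ)
    (hB : ∀ u : ι → ℝ, ((∑ l, C (u ⬝ᵥ (S l *ᵥ u)) * (X : ℝ[X]) ^ d l).roots.filter (fun t => 0 < t)).card ≤ B)
    (hsh : ∀ u : ι → ℝ, u ≠ 0 →
      B ≤ ((∑ l, C (u ⬝ᵥ (S l *ᵥ u)) * (X : ℝ[X]) ^ d l).roots.toFinset.filter (fun t => 0 < t)).card)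
    (u : ι → ℝ) (hu : u ≠ 0) :
    ((∑ l, C (u ⬝ᵥ (S l *ᵥ u)) * (X : ℝ[X]) ^ d l).roots.filter (fun t => 0 < t)).card
      ≤ ((∑ l, C (u ⬝ᵥ (S l *ᵥ u)) * (X : ℝ[X]) ^ d l).roots.toFinset.filter (fun t => 0 < t)).card :=
  (hB u).trans (hsh u hu)

/-- Increasing enumeration `Fin B → ℝ` of `T_u`. [folklore] -/
theorem budget_enum (d : Fin K → ℕ) (S : Fin K → Matrix ι ι ℝ) (B : ℕ)
    (hB : ∀ u : ι → ℝ, ((∑ l, C (u ⬝ᵥ (S l *ᵥ u)) * (X : ℝ[X]) ^ d l).roots.filter (fun t => 0 < t)).card ≤ B)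
    (hsh : ∀ u : ι → ℝ, u ≠ 0 →
      B ≤ ((∑ l, C (u ⬝ᵥ (S l *ᵥ u)) * (X : ℝ[X]) ^ d l).roots.toFinset.filter (fun t => 0 < t)).card)
    (u : ι → ℝ) (hu : u ≠ 0) :
    ∃ r : Fin B → ℝ, StrictMono r ∧
      ∀ x : ℝ, x ∈ ((∑ l, C (u ⬝ᵥ (S l *ᵥ u)) * (X : ℝ[X]) ^ d l).roots.toFinset.filter (fun t => 0 < t))
        ↔ ∃ i, r i = x := by
  set T := ((∑ l, C (u ⬝ᵥ (S l *ᵥ u)) * (X : ℝ[X]) ^ d l).roots.toFinset.filter (fun t => 0 < t)) with hT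
  have hcard : T.card = B := budget_card_eq d S B hB hsh u hu
  refine ⟨fun i => T.orderEmbOfFin hcard i, (T.orderEmbOfFin hcard).strictMono, fun x => ?_⟩
  constructor
  · intro hx
    have hx' : x ∈ Set.range (T.orderEmbOfFin hcard) := by rw [Finset.range_orderEmbOfFin]; exact hx
    obtain ⟨i, hi⟩ := hx'
    exact ⟨i, hi⟩
  · rintro ⟨i, rfl⟩
    exact Finset.orderEmbOfFin_mem T hcard i

/-- The budget bounds the distinct positive roots of every `P_u` (including `u` on a perturbation path). [folklore] -/
theorem budget_card_le (d : Fin K → ℕ) (S : Fin K → Matrix ι ι ℝ) (B : ℕ)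
    (hB : ∀ u : ι → ℝ, ((∑ l, C (u ⬝ᵥ (S l *ᵥ u)) * (X : ℝ[X]) ^ d l).roots.filter (fun t => 0 < t)).card ≤ B)
    (u : ι → ℝ) :
    ((∑ l, C (u ⬝ᵥ (S l *ᵥ u)) * (X : ℝ[X]) ^ d l).roots.toFinset.filter (fun t => 0 < t)).card ≤ B := by
  refine le_trans ?_ (hB u)
  rw [← Multiset.toFinset_filter]
  exact Multiset.toFinset_card_le _

/-- The budget in Rayleigh-form currency: every finite set of positive zeros of `x ↦ uᵀF(x)u` (`u ≠ 0`) has at most `B`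
elements (the hypothesis `hbudget` of `card_posRoots_le_of_definiteMoments`). [folklore] -/
theorem budget_form_le (d : Fin K → ℕ) (S : Fin K → Matrix ι ι ℝ) (B : ℕ) (s : ℝ)
    (hB : ∀ u : ι → ℝ, ((∑ l, C (u ⬝ᵥ (S l *ᵥ u)) * (X : ℝ[X]) ^ d l).roots.filter (fun t => 0 < t)).card ≤ B)
    (hs : ∀ u : ι → ℝ, u ≠ 0 → ∃ δ : ℝ, 0 < δ ∧ ∀ x : ℝ, 0 < x → x < δ →
      0 < s * (∑ l, C (u ⬝ᵥ (S l *ᵥ u)) * (X : ℝ[X]) ^ d l).eval x)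
    (u : ι → ℝ) (hu : u ≠ 0) (T : Finset ℝ) (hT : ∀ r ∈ T, 0 < r ∧ u ⬝ᵥ ((∑ k, r ^ d k • S k) *ᵥ u) = 0) :
    T.card ≤ B := by
  have hP0 := budget_ne_zero d S s hs u hu
  have hsub : T ⊆ (∑ l, C (u ⬝ᵥ (S l *ᵥ u)) * (X : ℝ[X]) ^ d l).roots.toFinset.filter (fun t => 0 < t) := by
    intro r hr
    rw [mem_posRoots_iff d S u hP0]
    exact hT r hr
  exact (Finset.card_le_card hsub).trans (budget_card_le d S B hB u)

/-- **THE PARITY LAW under the budget bundle.**  At every `u ≠ 0` and every positive non-root `x` of `P_u`: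
`0 < s·(−1)^{N(x,u)}·uᵀF(x)u`. [folklore] -/
theorem budget_sign_law (d : Fin K → ℕ) (S : Fin K → Matrix ι ι ℝ) (B : ℕ) (s : ℝ)
    (hB : ∀ u : ι → ℝ, ((∑ l, C (u ⬝ᵥ (S l *ᵥ u)) * (X : ℝ[X]) ^ d l).roots.filter (fun t => 0 < t)).card ≤ B)
    (hsh : ∀ u : ι → ℝ, u ≠ 0 →
      B ≤ ((∑ l, C (u ⬝ᵥ (S l *ᵥ u)) * (X : ℝ[X]) ^ d l).roots.toFinset.filter (fun t => 0 < t)).card)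
    (hs : ∀ u : ι → ℝ, u ≠ 0 → ∃ δ : ℝ, 0 < δ ∧ ∀ x : ℝ, 0 < x → x < δ →
      0 < s * (∑ l, C (u ⬝ᵥ (S l *ᵥ u)) * (X : ℝ[X]) ^ d l).eval x)
    (u : ι → ℝ) (hu : u ≠ 0) {x : ℝ} (hx : 0 < x)
    (hxr : ¬ (∑ l, C (u ⬝ᵥ (S l *ᵥ u)) * (X : ℝ[X]) ^ d l).IsRoot x) :
    0 < s * (-1) ^ ((∑ l, C (u ⬝ᵥ (S l *ᵥ u)) * (X : ℝ[X]) ^ d l).roots.toFinset.filter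
        (fun t => 0 < t ∧ t < x)).card * (u ⬝ᵥ ((∑ k, x ^ d k • S k) *ᵥ u)) := by
  rw [← eval_rayleighPoly]
  exact sharp_sign_law _ (budget_ne_zero d S s hs u hu) (budget_multiset d S B hB hsh u hu) s (hs u hu) x hx hxr

/-- **The Rayleigh-sharp pencil satisfies the bundle** with `B = K − 1` and `s = σ` (the global letter sign): budget by
Descartes' rule with multiplicity, sharpness by hypothesis, sign by the lowest letter. [folklore] -/
theorem budget_of_rayleighSharp (hK : 2 ≤ K) (d : Fin K → ℕ) (hd : StrictMono d) (S : Fin K → Matrix ι ι ℝ)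
    (hsharp : ∀ v : ι → ℝ, v ≠ 0 →
      K ≤ ((∑ l, C (v ⬝ᵥ (S l *ᵥ v)) * (X : ℝ[X]) ^ d l).roots.toFinset.filter (fun t => 0 < t)).card + 1)
    (σ : ℝ) (hσ : ∀ (l : Fin K) (v : ι → ℝ), v ≠ 0 → 0 < σ * (-1) ^ (l : ℕ) * (v ⬝ᵥ (S l *ᵥ v))) :
    (∀ u : ι → ℝ, ((∑ l, C (u ⬝ᵥ (S l *ᵥ u)) * (X : ℝ[X]) ^ d l).roots.filter (fun t => 0 < t)).card ≤ K - 1) ∧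
    (∀ u : ι → ℝ, u ≠ 0 →
      K - 1 ≤ ((∑ l, C (u ⬝ᵥ (S l *ᵥ u)) * (X : ℝ[X]) ^ d l).roots.toFinset.filter (fun t => 0 < t)).card) ∧
    (∀ u : ι → ℝ, u ≠ 0 → ∃ δ : ℝ, 0 < δ ∧ ∀ x : ℝ, 0 < x → x < δ →
      0 < σ * (∑ l, C (u ⬝ᵥ (S l *ᵥ u)) * (X : ℝ[X]) ^ d l).eval x) := by
  refine ⟨fun u => ?_, fun u hu => by have := hsharp u hu; omega, fun u hu => rayleigh_near_zero hK d hd S σ hσ u hu⟩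
  -- Descartes with multiplicity: `#roots_{>0} ≤ Var ≤ #support − 1 ≤ K − 1`
  set P := ∑ l, C (u ⬝ᵥ (S l *ᵥ u)) * (X : ℝ[X]) ^ d l with hP
  by_cases hP0 : P = 0
  · rw [hP0, Polynomial.roots_zero, Multiset.filter_zero, Multiset.card_zero]; exact Nat.zero_le _
  have h1 : (P.roots.filter (fun t => 0 < t)).card ≤ P.signVariations := by
    rw [← Multiset.countP_eq_card_filter]; exact P.roots_countP_pos_le_signVariations
  have h2 := Literature.Computability.AlgebraicComplexity.signVariations_lt_card_support hP0
  have h3 : P.support.card ≤ K := by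
    refine (Literature.Computability.AlgebraicComplexity.card_support_sum_le _ _).trans ?_
    calc ∑ k, (C (u ⬝ᵥ (S k *ᵥ u)) * (X : ℝ[X]) ^ d k).support.card
        ≤ ∑ _k : Fin K, 1 := Finset.sum_le_sum fun k _ => Polynomial.card_support_C_mul_X_pow_le_one
      _ = K := by rw [Finset.sum_const, Finset.card_univ, Fintype.card_fin, smul_eq_mul, mul_one]
  omega

end Budget

end DefiniteMoments

end Summit.ValiantsHypothesis.ValiantsHypothesis.Theorems.LacunarySymmetroidMatrixDescartes
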